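import Literature.NumberTheory.GaloisRepresentations.LubinTateColemanTwoVariableCokernelCyclicTwo
import Literature.NumberTheory.GaloisRepresentations.LubinTateColemanTwoVariableTwistGaloisTwo
import Literature.NumberTheory.GaloisRepresentations.LubinTateUnramifiedAnomalyCokernelExact
import Literature.NumberTheory.GaloisRepresentations.LubinTateComparisonUnramified
import HarnessLib

/-!
# The LEVELWISE Amice–CRT correspondence `(𝒪_F⟦X⟧)^{ℤ/d} ∋ x ↔ y ∈ 𝒪_{E_m}` of the unramified tower, as a named predicate with its
# calculus (uniqueness, linearity, Frobenius powers = shift ⊗ `(1+X)^t`, reduction modulo `ω_m`), and the ANOMALY RANGE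
# `(1 − uφ)𝒪_{E_m} ⊇ π^N 𝒪_{E_m}` with the induced ADMISSIBILITY condition — the constant-term bookkeeping of de Shalit's (17)

De Shalit, *Iwasawa theory of elliptic curves with complex multiplication* (1987), Ch. I §3.1, §3.7 Theorem, §3.8 (16)–(17); Ch. III §1.3.
The tree proves the structure theorem of the two-variable Coleman transform in "family" currency: the transform `Col β : ℤ/d → 𝒪_F⟦X⟧⟦Y⟧`
of a norm-coherent unit family is characterised by congruences modulo `ω_m = (1+X)^{p^m} − 1` against the level-`m` coordinates
(`LubinTateColemanTwoVariableTransformCyclicTwo`), and its image is cut out by ONE condition on constant terms: the level-`m` constant term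
lies in `(1 − uφ_m)𝒪_{E_m}` (`LubinTateColemanTwoVariableLimitTwo.exists_baseNormCoherent_principal_iff`).  To package the image as a
SUBMODULE over the Iwasawa algebra (sequel `LubinTateColemanUnitsImageModuleTwo`) one needs this bookkeeping LEVEL BY LEVEL and for the
`Y`-constant terms only.  THIS file isolates it:

* §1 `amiceSum`, **`IsAmiceLevel p d hd E σ₀ hθ m x y`** — the level-`m` congruences `ω_m ∣ x j − Σ_i a_y(φ_m^{χ_m⁻¹(j,i)})(1+X)^i`
  between `x : ℤ/d → 𝒪_F⟦X⟧` and `y ∈ 𝒪_{E_m}` (the tree's inlined text, named); `exists_isAmiceLevel` (from the trace-coherent inverse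
  `existsUnique_traceCoherent_of_seriesProd`), ★ `IsAmiceLevel.unique` (`eq_of_forall_omega_dvd_sub_sum`), `.congr_of_dvd` (only `x mod ω_m`
  matters), `.add/.neg/.sub/.zero/.smul` (`𝒪_F`-linearity), ★ `.frobPow` (levelwise `amiceProd_frobPow`: `(1+X)^t·x(· − t) ↔ φ_m^t y`) and
  ★★ `.one_add_X_pow_mul` — **`(1+X)^i · x ↔ φ_m^{i·t_m} y` with NO shift**, `t_m = d·(d⁻¹ mod p^m)` (CRT: `d ∣ t_m`, `t_m ≡ 1 (p^m)`);
* §2 the anomaly range **`anomalyRange E σ₀ u = (1 − uφ)𝒪_E`** (an `𝒪_F`-submodule, `φ`-stable) and ★ `exists_pow_smul_mem_anomalyRange`: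
  **`π^N 𝒪_E ⊆ (1 − uφ)𝒪_E` for some `N`** when `u^{[E:F]} ≠ 1` (`exists_functional_anomaly_cokernel` + `1 − u^{[E:F]} = π^N·unit` in the
  DVR `𝒪_F`); `frobUnitBall_sub_smul_mem_anomalyRange` (`φ y − u⁻¹… `: `(uφ − 1) y ∈ (1 − uφ)𝒪_E`, so `φ` acts as the scalar `u⁻¹` modulo it);
* §3 **`IsAdmissibleLevel … m x`** — "the level-`m` partner of `x` lies in `(1 − uφ_m)𝒪_{E_m}`" — and its closure under `+`, `𝒪_F`-scalars,
  reduction mod `ω_m`, multiplication by `(1+X)^i`, by ANY `s ∈ 𝒪_F⟦X⟧` (★ `IsAdmissibleLevel.C_mul`, via `existsUnique_omega_dvd_sub_amice`),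
  and ★ `isAdmissibleLevel_of_forall_dvd` (`x ≡ 0 (mod π^N)` componentwise ⟹ admissible, `N` the anomaly exponent).

Everything PROVED (0 sorry, no named facts); definitions `amiceSum`, `IsAmiceLevel`, `frobExp`, `anomalyRange`, `IsAdmissibleLevel` are
transparent abbreviations of texts already inlined across the lane's files.

## References
* E. de Shalit, *Iwasawa theory of elliptic curves with complex multiplication* (1987), Ch. I §3.1, §3.7, §3.8 (16)–(17); Ch. III §1.3. [deShalit1987]
* L. C. Washington, *Introduction to Cyclotomic Fields*, 2nd ed. (1997), §7.1. [Washington1997]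
-/

noncomputable section

namespace Literature.NumberTheory.GaloisRepresentations
section AmiceLevel

open GaloisRepresentations.IsNonarchimedeanLocalField LubinTate ValuativeRel Field Finset
open Literature.NumberTheory.EllipticCurves.IwasawaOmega

variable {F : Type} [Field F] [ValuativeRel F] [TopologicalSpace F] [IsNonarchimedeanLocalField F]

attribute [local instance] ltNormUniformSpace ltNormIsUniformAddGroup rk1 nF nE fintypeResidueField

variable (p : ℕ) [hp : Fact p.Prime] (d : ℕ) (hd : d.Coprime p)
variable {π : 𝒪[F]} (hπ : (valuation F).IsUniformizer (π : F))
variable (E : ℕ → IntermediateField F (AlgebraicClosure F)) [∀ m, FiniteDimensional F (E m)] [∀ m, Normal F (E m)]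
  [∀ m, IsGalois F (E m)] (hmono : Monotone E) (hE : ∀ m, E m ≤ maxUnramified F) (hdeg : ∀ m, Module.finrank F (E m) = d * p ^ m)
  (σ₀ : absoluteGaloisGroup F) (hσ₀ : IsAbsArithFrob σ₀)

/-! ### §1. The level-`m` Amice sum and the predicate `IsAmiceLevel` -/

variable {E} in
/-- **The level-`m` Amice sum** `Φ_m(y)(j) := Σ_{i ∈ ℤ/p^m} C(a_y(φ_m^{χ_m⁻¹(j,i)}))·(1+X)^i ∈ 𝒪_F⟦X⟧` of `y ∈ 𝒪_{E_m}` (`a_y` the coordinates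
in the normal integral basis generated by `θ_m`, `χ_m : ℤ/dp^m ≃ ℤ/d × ℤ/p^m` the CRT isomorphism). [cite: deShalit1987, Ch. I §3.1, §3.8 (17)] -/
def amiceSum {m : ℕ} {θ : unitBall (E m)} (hθ : IsIntegralNormalGen (E m) θ) (y : unitBall (E m)) (j : ZMod d) : PowerSeries 𝒪[F] :=
  ∑ i : ZMod (p ^ m), PowerSeries.C (hθ.basis.repr y
    (((absoluteGaloisGroup.toAlgEquiv F σ₀).restrictNormal (E m)) ^ ((ZMod.chineseRemainder (hd.pow_right m)).symm (j, i)).val)) *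
      (1 + PowerSeries.X) ^ i.val

variable {E} in
/-- **`IsAmiceLevel … hθ x y`** (level `m`): `ω_m ∣ x j − Φ_m(y)(j)` for every `j ∈ ℤ/d` — `y ∈ 𝒪_{E_m}` is the level-`m` partner of
`x ∈ (𝒪_F⟦X⟧)^{ℤ/d} = Λ(ℤ/d × ℤ_p, 𝒪_F)`. [cite: deShalit1987, Ch. I §3.1, §3.8 (17)] -/
def IsAmiceLevel {m : ℕ} {θ : unitBall (E m)} (hθ : IsIntegralNormalGen (E m) θ) (x : ZMod d → PowerSeries 𝒪[F]) (y : unitBall (E m)) : Prop :=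
  ∀ j : ZMod d, ((1 + PowerSeries.X : PowerSeries 𝒪[F]) ^ p ^ m - 1) ∣ x j - amiceSum p d hd σ₀ hθ y j

/-! ### The shift-free exponent `t_m = d·(d⁻¹ mod p^m)`: `d ∣ t_m`, `t_m ≡ 1 (mod p^m)` -/

/-- **`t_m := d · (d⁻¹ mod p^m).val`** — a natural number divisible by `d` and `≡ 1 (mod p^m)` (`p ∤ d`). [cite: deShalit1987, Ch. I §3.1] -/
def frobExp (m : ℕ) : ℕ := d * ((d : ZMod (p ^ m))⁻¹).val

omit hp in
/-- `d ∣ t_m`. [cite: deShalit1987, Ch. I §3.1] -/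
theorem dvd_frobExp (m : ℕ) : d ∣ frobExp p d m := dvd_mul_right _ _

omit hp in
/-- `(t_m : ℤ/d) = 0`. [cite: deShalit1987, Ch. I §3.1] -/
theorem natCast_frobExp_zmod (m : ℕ) : ((frobExp p d m : ℕ) : ZMod d) = 0 :=
  (ZMod.natCast_eq_zero_iff _ _).mpr (dvd_frobExp p d m)

include hd in
/-- `t_m ≡ 1 (mod p^m)`. [cite: deShalit1987, Ch. I §3.1] -/
theorem frobExp_modEq_one (m : ℕ) : frobExp p d m ≡ 1 [MOD p ^ m] := by
  rw [← ZMod.natCast_eq_natCast_iff, frobExp, Nat.cast_mul, ZMod.natCast_val, ZMod.cast_id', id, Nat.cast_one]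
  exact ZMod.mul_inv_of_unit _ ((ZMod.isUnit_iff_coprime d (p ^ m)).mpr (hd.pow_right m))

include hd in
/-- `i·t_m ≡ i (mod p^m)`. [cite: deShalit1987, Ch. I §3.1] -/
theorem mul_frobExp_modEq (m i : ℕ) : i * frobExp p d m ≡ i [MOD p ^ m] := by
  simpa using (frobExp_modEq_one p d hd m).mul_left i

variable {p d hd E σ₀}
variable {m : ℕ} {θm : unitBall (E m)} {hθm : IsIntegralNormalGen (E m) θm}

/-- Unfolding `IsAmiceLevel`. [cite: deShalit1987, Ch. I §3.8 (17)] -/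
theorem isAmiceLevel_iff (x : ZMod d → PowerSeries 𝒪[F]) (y : unitBall (E m)) :
    IsAmiceLevel p d hd σ₀ hθm x y ↔ ∀ j : ZMod d, ((1 + PowerSeries.X : PowerSeries 𝒪[F]) ^ p ^ m - 1) ∣
      x j - ∑ i : ZMod (p ^ m), PowerSeries.C (hθm.basis.repr y
        (((absoluteGaloisGroup.toAlgEquiv F σ₀).restrictNormal (E m)) ^ ((ZMod.chineseRemainder (hd.pow_right m)).symm (j, i)).val)) *
          (1 + PowerSeries.X) ^ i.val := Iff.rfl

/-- `Φ_m` is additive. [cite: deShalit1987, Ch. I §3.1] -/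
theorem amiceSum_add (y y' : unitBall (E m)) (j : ZMod d) :
    amiceSum p d hd σ₀ hθm (y + y') j = amiceSum p d hd σ₀ hθm y j + amiceSum p d hd σ₀ hθm y' j := by
  rw [amiceSum, amiceSum, amiceSum, ← sum_add_distrib]
  exact sum_congr rfl fun i _ => by rw [map_add, Finsupp.add_apply, map_add, add_mul]

/-- `Φ_m` is `𝒪_F`-linear. [cite: deShalit1987, Ch. I §3.1] -/
theorem amiceSum_smul (a : 𝒪[F]) (y : unitBall (E m)) (j : ZMod d) :
    amiceSum p d hd σ₀ hθm (a • y) j = PowerSeries.C a * amiceSum p d hd σ₀ hθm y j := by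
  rw [amiceSum, amiceSum, mul_sum]
  exact sum_congr rfl fun i _ => by rw [map_smul, Finsupp.smul_apply, smul_eq_mul, map_mul, mul_assoc]

/-- `Φ_m(0) = 0`. [cite: deShalit1987, Ch. I §3.1] -/
theorem amiceSum_zero (j : ZMod d) : amiceSum p d hd σ₀ hθm 0 j = 0 := by
  rw [amiceSum]
  exact sum_eq_zero fun i _ => by rw [map_zero, Finsupp.zero_apply, map_zero, zero_mul]

namespace IsAmiceLevel

/-- `(0, 0)` is an Amice pair. [cite: deShalit1987, Ch. I §3.1] -/
theorem zero : IsAmiceLevel p d hd σ₀ hθm (fun _ => 0) 0 := fun j => by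
  rw [amiceSum_zero, sub_zero]; exact dvd_zero _

/-- Amice pairs add. [cite: deShalit1987, Ch. I §3.1] -/
theorem add {x x' : ZMod d → PowerSeries 𝒪[F]} {y y' : unitBall (E m)} (h : IsAmiceLevel p d hd σ₀ hθm x y)
    (h' : IsAmiceLevel p d hd σ₀ hθm x' y') : IsAmiceLevel p d hd σ₀ hθm (x + x') (y + y') := fun j => by
  rw [amiceSum_add, Pi.add_apply, add_sub_add_comm]
  exact dvd_add (h j) (h' j)

/-- Amice pairs are stable under `𝒪_F`-scalars: `(C a · x, a • y)`. [cite: deShalit1987, Ch. I §3.1] -/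
theorem smul {x : ZMod d → PowerSeries 𝒪[F]} {y : unitBall (E m)} (h : IsAmiceLevel p d hd σ₀ hθm x y) (a : 𝒪[F]) :
    IsAmiceLevel p d hd σ₀ hθm (fun j => PowerSeries.C a * x j) (a • y) := fun j => by
  rw [amiceSum_smul, ← mul_sub]
  exact dvd_mul_of_dvd_right (h j) _

/-- Amice pairs negate. [cite: deShalit1987, Ch. I §3.1] -/
theorem neg {x : ZMod d → PowerSeries 𝒪[F]} {y : unitBall (E m)} (h : IsAmiceLevel p d hd σ₀ hθm x y) :
    IsAmiceLevel p d hd σ₀ hθm (-x) (-y) := fun j => by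
  have h1 := h.smul (-1)
  have e1 : (fun j => PowerSeries.C (-1 : 𝒪[F]) * x j) = -x := funext fun j => by rw [map_neg, map_one, neg_one_mul, Pi.neg_apply]
  rw [e1, neg_one_smul] at h1
  exact h1 j

/-- Amice pairs subtract. [cite: deShalit1987, Ch. I §3.1] -/
theorem sub {x x' : ZMod d → PowerSeries 𝒪[F]} {y y' : unitBall (E m)} (h : IsAmiceLevel p d hd σ₀ hθm x y)
    (h' : IsAmiceLevel p d hd σ₀ hθm x' y') : IsAmiceLevel p d hd σ₀ hθm (x - x') (y - y') := by
  rw [sub_eq_add_neg, sub_eq_add_neg]; exact h.add h'.neg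

/-- **Only `x mod ω_m` matters**: if `ω_m ∣ x j − x' j` for all `j` then the partners agree. [cite: deShalit1987, Ch. I §3.8 (17)] -/
theorem congr_of_dvd {x x' : ZMod d → PowerSeries 𝒪[F]} {y : unitBall (E m)} (h : IsAmiceLevel p d hd σ₀ hθm x y)
    (hxx' : ∀ j, ((1 + PowerSeries.X : PowerSeries 𝒪[F]) ^ p ^ m - 1) ∣ x j - x' j) : IsAmiceLevel p d hd σ₀ hθm x' y := fun j => by
  have e : x' j - amiceSum p d hd σ₀ hθm y j = (x j - amiceSum p d hd σ₀ hθm y j) - (x j - x' j) := by ring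
  rw [e]
  exact dvd_sub (h j) (hxx' j)

include hE hdeg hσ₀ in
/-- ★ **Uniqueness of the partner** (`eq_of_forall_omega_dvd_sub_sum`): at level `m` the congruences determine `y`.
[cite: deShalit1987, Ch. I §3.8 (17)] -/
theorem unique [NeZero d] [IsAdicComplete (Ideal.span {(p : 𝒪[F])}) 𝒪[F]] (hI : Ideal.span {(p : 𝒪[F])} ≠ ⊤) {x : ZMod d → PowerSeries 𝒪[F]}
    {y y' : unitBall (E m)} (h : IsAmiceLevel p d hd σ₀ hθm x y) (h' : IsAmiceLevel p d hd σ₀ hθm x y') : y = y' :=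
  eq_of_forall_omega_dvd_sub_sum p d hd E hE hdeg hσ₀ hI hθm x h h'

include hE hdeg hσ₀ in
/-- ★ **Frobenius powers = shift ⊗ `(1+X)^t`** (levelwise `amiceProd_frobPow`): if `(x, y)` is a level-`m` Amice pair then so is
`(j ↦ (1+X)^t x(j − t), φ_m^t y)`. [cite: deShalit1987, Ch. I §3.1, §3.8 (17)] -/
theorem frobPow [NeZero d] {x : ZMod d → PowerSeries 𝒪[F]} {y : unitBall (E m)} (h : IsAmiceLevel p d hd σ₀ hθm x y) (t : ℕ) :
    IsAmiceLevel p d hd σ₀ hθm (fun j => (1 + PowerSeries.X) ^ t * x (j - t))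
      (unitBallEquiv (E m) (((absoluteGaloisGroup.toAlgEquiv F σ₀).restrictNormal (E m)) ^ t) y) := fun j => by
  have e : amiceSum p d hd σ₀ hθm (unitBallEquiv (E m) (((absoluteGaloisGroup.toAlgEquiv F σ₀).restrictNormal (E m)) ^ t) y) j =
      ∑ i : ZMod (p ^ m), PowerSeries.C (hθm.basis.repr y
        (((absoluteGaloisGroup.toAlgEquiv F σ₀).restrictNormal (E m)) ^ ((ZMod.chineseRemainder (hd.pow_right m)).symm (j, i) - t).val)) *
          (1 + PowerSeries.X) ^ i.val :=
    sum_congr rfl fun i _ => by rw [repr_frobPow_frobPow_cyclic p d E hE hdeg hσ₀]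
  rw [e]
  exact omega_dvd_pow_mul_amice_sub_amice_translate p d hd m
    (fun z : ZMod (d * p ^ m) => hθm.basis.repr y (((absoluteGaloisGroup.toAlgEquiv F σ₀).restrictNormal (E m)) ^ z.val)) x h t j

end IsAmiceLevel

namespace IsAmiceLevel

include hd hE hdeg hσ₀ in
/-- ★★ **Multiplication by `(1+X)^i` WITHOUT shift ↔ `φ_m^{i·t_m}`**: if `(x, y)` is a level-`m` Amice pair then so is
`(j ↦ (1+X)^i · x j, φ_m^{i t_m} y)` (`d ∣ i t_m` kills the shift, `(1+X)^{i t_m} ≡ (1+X)^i (mod ω_m)` since `i t_m ≡ i (mod p^m)`).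
[cite: deShalit1987, Ch. I §3.1, §3.8 (17)] -/
theorem one_add_X_pow_mul [NeZero d] {x : ZMod d → PowerSeries 𝒪[F]} {y : unitBall (E m)} (h : IsAmiceLevel p d hd σ₀ hθm x y) (i : ℕ) :
    IsAmiceLevel p d hd σ₀ hθm (fun j => (1 + PowerSeries.X) ^ i * x j)
      (unitBallEquiv (E m) (((absoluteGaloisGroup.toAlgEquiv F σ₀).restrictNormal (E m)) ^ (i * frobExp p d m)) y) := by
  refine (h.frobPow hE hdeg hσ₀ (i * frobExp p d m)).congr_of_dvd fun j => ?_
  have hj : (j - (i * frobExp p d m : ℕ) : ZMod d) = j := by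
    rw [Nat.cast_mul, natCast_frobExp_zmod, mul_zero, sub_zero]
  rw [hj, ← sub_mul]
  exact dvd_mul_of_dvd_left (omega_dvd_pow_sub_pow_of_modEq p (mul_frobExp_modEq p d hd m i)) _

include hd hE hdeg hσ₀ in
/-- The case `i = 1`: `(1+X)·x ↔ φ_m^{t_m} y`. [cite: deShalit1987, Ch. I §3.1, §3.8 (17)] -/
theorem one_add_X_mul [NeZero d] {x : ZMod d → PowerSeries 𝒪[F]} {y : unitBall (E m)} (h : IsAmiceLevel p d hd σ₀ hθm x y) :
    IsAmiceLevel p d hd σ₀ hθm (fun j => (1 + PowerSeries.X) * x j)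
      (unitBallEquiv (E m) (((absoluteGaloisGroup.toAlgEquiv F σ₀).restrictNormal (E m)) ^ frobExp p d m) y) := by
  have h1 := h.one_add_X_pow_mul hE hdeg hσ₀ 1
  simp only [pow_one, one_mul] at h1
  exact h1

end IsAmiceLevel

/-! ### Existence of partners (from the trace-coherent inverse of the transform) -/

include hE hdeg hσ₀ in
/-- ★ **Every `x ∈ (𝒪_F⟦X⟧)^{ℤ/d}` has a level-`m` partner** (the level-`m` term of its trace-coherent preimage
`existsUnique_traceCoherent_of_seriesProd`). [cite: deShalit1987, Ch. I §3.8 (17)] -/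
theorem exists_isAmiceLevel [NeZero d] [IsAdicComplete (Ideal.span {(p : 𝒪[F])}) 𝒪[F]] (hI : Ideal.span {(p : 𝒪[F])} ≠ ⊤)
    {θ : ∀ m, unitBall (E m)} (hθ : ∀ m, IsIntegralNormalGen (E m) (θ m))
    (hcoh : ∀ m, unitBallTrace (hmono (Nat.le_succ m)) (θ (m + 1)) = θ m) (x : ZMod d → PowerSeries 𝒪[F]) (m : ℕ) :
    ∃ y : unitBall (E m), IsAmiceLevel p d hd σ₀ (hθ m) x y := by
  obtain ⟨yf, ⟨-, hyf⟩, -⟩ := existsUnique_traceCoherent_of_seriesProd p d hd E hmono hE hdeg hσ₀ hI hθ hcoh x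
  exact ⟨yf m, fun j => hyf m j⟩

/-! ### §2. The anomaly range `(1 − uφ)𝒪_E` -/

section Anomaly

variable (E' : IntermediateField F (AlgebraicClosure F)) [FiniteDimensional F E'] [Normal F E']

variable (σ₀) in
/-- **The anomaly range `(1 − uφ)𝒪_E := {c − u·φ(c) : c ∈ 𝒪_E}`** as an `𝒪_F`-submodule of `𝒪_E` (`φ` the Frobenius of `𝒪_E` attached to
`σ₀`, `u ∈ 𝒪_F`); its cokernel is de Shalit's `(𝒪/p^N)(1)` of Theorem I.3.7. [cite: deShalit1987, Ch. I §3.7 Theorem] -/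
def anomalyRange (u : 𝒪[F]) : Submodule 𝒪[F] (unitBall E') where
  carrier := {c' | ∃ c : unitBall E', c' = c - algebraMap 𝒪[F] (unitBall E') u * (frobUnitBall E' σ₀ : unitBall E' →+* unitBall E') c}
  zero_mem' := ⟨0, by rw [map_zero, mul_zero, sub_zero]⟩
  add_mem' := by
    rintro _ _ ⟨c, rfl⟩ ⟨c', rfl⟩
    exact ⟨c + c', by rw [map_add]; ring⟩
  smul_mem' := by
    rintro a _ ⟨c, rfl⟩
    refine ⟨a • c, ?_⟩
    rw [Algebra.smul_def, Algebra.smul_def, map_mul, frobUnitBall_algebraMap]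
    ring

/-- Membership in the anomaly range (unfolding). [cite: deShalit1987, Ch. I §3.7 Theorem] -/
theorem mem_anomalyRange_iff (u : 𝒪[F]) (c' : unitBall E') :
    c' ∈ anomalyRange σ₀ E' u ↔ ∃ c : unitBall E', c' = c - algebraMap 𝒪[F] (unitBall E') u * (frobUnitBall E' σ₀ : unitBall E' →+* unitBall E') c :=
  Iff.rfl

variable {E'}

/-- The anomaly range is stable under the Frobenius (`φ` commutes with `1 − uφ`). [cite: deShalit1987, Ch. I §3.7 Theorem] -/
theorem frobUnitBall_mem_anomalyRange {u : 𝒪[F]} {c' : unitBall E'} (h : c' ∈ anomalyRange σ₀ E' u) :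
    (frobUnitBall E' σ₀ : unitBall E' →+* unitBall E') c' ∈ anomalyRange σ₀ E' u := by
  obtain ⟨c, rfl⟩ := h
  exact ⟨(frobUnitBall E' σ₀ : unitBall E' →+* unitBall E') c, by rw [map_sub, map_mul, frobUnitBall_algebraMap]⟩

/-- … and under its powers. [cite: deShalit1987, Ch. I §3.7 Theorem] -/
theorem frobUnitBall_pow_mem_anomalyRange {u : 𝒪[F]} (t : ℕ) {c' : unitBall E'} (h : c' ∈ anomalyRange σ₀ E' u) :
    ((frobUnitBall E' σ₀ : unitBall E' →+* unitBall E') ^ t) c' ∈ anomalyRange σ₀ E' u := by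
  induction t with
  | zero => rw [pow_zero, RingHom.one_def, RingHom.id_apply]; exact h
  | succ t ih => rw [pow_succ', RingHom.mul_def, RingHom.comp_apply]; exact frobUnitBall_mem_anomalyRange ih

/-- … written with `unitBallEquiv` of the power of `σ₀|_E`. [cite: deShalit1987, Ch. I §3.7 Theorem] -/
theorem unitBallEquiv_pow_mem_anomalyRange {u : 𝒪[F]} (t : ℕ) {c' : unitBall E'} (h : c' ∈ anomalyRange σ₀ E' u) :
    unitBallEquiv E' (((absoluteGaloisGroup.toAlgEquiv F σ₀).restrictNormal E') ^ t) c' ∈ anomalyRange σ₀ E' u := by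
  rw [← frobUnitBall_pow_apply]
  exact frobUnitBall_pow_mem_anomalyRange t h

/-- **`uφ ≡ 1` modulo the anomaly range**: `u·φ(c) − c ∈ (1 − uφ)𝒪_E`. [cite: deShalit1987, Ch. I §3.7 Theorem] -/
theorem algebraMap_mul_frobUnitBall_sub_mem_anomalyRange (u : 𝒪[F]) (c : unitBall E') :
    algebraMap 𝒪[F] (unitBall E') u * (frobUnitBall E' σ₀ : unitBall E' →+* unitBall E') c - c ∈ anomalyRange σ₀ E' u := by
  have h : c - algebraMap 𝒪[F] (unitBall E') u * (frobUnitBall E' σ₀ : unitBall E' →+* unitBall E') c ∈ anomalyRange σ₀ E' u := ⟨c, rfl⟩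
  have h' := Submodule.neg_mem _ h
  rwa [neg_sub] at h'

include hπ in
/-- ★ **`π^N 𝒪_E ⊆ (1 − uφ)𝒪_E` for some `N`** (`E ⊆ F^{nr}` finite Galois, `u^{[E:F]} ≠ 1`): the cokernel `𝒪_E/(1 − uφ)𝒪_E ≅ 𝒪_F/(1 − u^{[E:F]})`
(`exists_functional_anomaly_cokernel`) is killed by `1 − u^{[E:F]} = π^N·(unit)` — de Shalit's FINITE anomaly index. [cite: deShalit1987, Ch. I §3.7 Theorem] -/
theorem exists_pow_smul_mem_anomalyRange [IsGalois F E'] (hE' : E' ≤ maxUnramified F) {σ₀' : absoluteGaloisGroup F} (hσ₀' : IsAbsArithFrob σ₀')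
    (u : 𝒪[F]) (hud : 1 - u ^ Module.finrank F E' ≠ 0) :
    ∃ N : ℕ, ∀ c : unitBall E', π ^ N • c ∈ anomalyRange σ₀' E' u := by
  obtain ⟨lam, -, hlam⟩ := exists_functional_anomaly_cokernel hπ E' hE' hσ₀' u hud
  obtain ⟨N, w, hw⟩ := IsDiscreteValuationRing.eq_unit_mul_pow_irreducible hud (irreducible_of_isUniformizer' hπ)
  refine ⟨N, fun c => (hlam (π ^ N • c)).mpr ?_⟩
  rw [map_smul, smul_eq_mul]
  refine Ideal.mem_span_singleton.mpr ⟨(↑w⁻¹ : 𝒪[F]) * lam c, ?_⟩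
  rw [hw]
  calc π ^ N * lam c = ((w : 𝒪[F]) * ↑w⁻¹) * (π ^ N * lam c) := by rw [Units.mul_inv, one_mul]
    _ = (w : 𝒪[F]) * π ^ N * (↑w⁻¹ * lam c) := by ring

end Anomaly

/-! ### §3. Admissibility at level `m`: the partner lies in the anomaly range -/

variable (p d hd σ₀) in
/-- **`IsAdmissibleLevel … hθ u x`**: `x ∈ (𝒪_F⟦X⟧)^{ℤ/d}` has a level-`m` partner in `(1 − uφ_m)𝒪_{E_m}` — the level-`m` component of the
image condition of de Shalit's (17) (`exists_baseNormCoherent_principal_iff`). [cite: deShalit1987, Ch. I §3.7, §3.8 (17)] -/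
def IsAdmissibleLevel {m : ℕ} {θ : unitBall (E m)} (hθ : IsIntegralNormalGen (E m) θ) (u : 𝒪[F]) (x : ZMod d → PowerSeries 𝒪[F]) : Prop :=
  ∃ y : unitBall (E m), IsAmiceLevel p d hd σ₀ hθ x y ∧ y ∈ anomalyRange σ₀ (E m) u

namespace IsAdmissibleLevel

variable {u : 𝒪[F]}

/-- `0` is admissible. [cite: deShalit1987, Ch. I §3.8 (17)] -/
theorem zero : IsAdmissibleLevel p d hd σ₀ hθm u (fun _ => 0) := ⟨0, IsAmiceLevel.zero, Submodule.zero_mem _⟩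

/-- Admissible elements add. [cite: deShalit1987, Ch. I §3.8 (17)] -/
theorem add {x x' : ZMod d → PowerSeries 𝒪[F]} (h : IsAdmissibleLevel p d hd σ₀ hθm u x) (h' : IsAdmissibleLevel p d hd σ₀ hθm u x') :
    IsAdmissibleLevel p d hd σ₀ hθm u (x + x') := by
  obtain ⟨y, hy, hyR⟩ := h
  obtain ⟨y', hy', hy'R⟩ := h'
  exact ⟨y + y', hy.add hy', Submodule.add_mem _ hyR hy'R⟩

/-- Admissible elements negate. [cite: deShalit1987, Ch. I §3.8 (17)] -/
theorem neg {x : ZMod d → PowerSeries 𝒪[F]} (h : IsAdmissibleLevel p d hd σ₀ hθm u x) : IsAdmissibleLevel p d hd σ₀ hθm u (-x) := by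
  obtain ⟨y, hy, hyR⟩ := h
  exact ⟨-y, hy.neg, Submodule.neg_mem _ hyR⟩

/-- Admissible elements subtract. [cite: deShalit1987, Ch. I §3.8 (17)] -/
theorem sub {x x' : ZMod d → PowerSeries 𝒪[F]} (h : IsAdmissibleLevel p d hd σ₀ hθm u x) (h' : IsAdmissibleLevel p d hd σ₀ hθm u x') :
    IsAdmissibleLevel p d hd σ₀ hθm u (x - x') := by
  rw [sub_eq_add_neg]; exact h.add h'.neg

/-- Finite sums of admissible elements are admissible. [cite: deShalit1987, Ch. I §3.8 (17)] -/
theorem sum {ι : Type*} (s : Finset ι) {f : ι → ZMod d → PowerSeries 𝒪[F]} (h : ∀ i ∈ s, IsAdmissibleLevel p d hd σ₀ hθm u (f i)) :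
    IsAdmissibleLevel p d hd σ₀ hθm u (∑ i ∈ s, f i) := by
  classical
  induction s using Finset.induction_on with
  | empty => rw [sum_empty]; exact zero
  | insert a s ha ih =>
    rw [sum_insert ha]
    exact (h a (mem_insert_self a s)).add (ih fun i hi => h i (mem_insert_of_mem hi))

/-- Admissibility is stable under `𝒪_F`-scalars `C a`. [cite: deShalit1987, Ch. I §3.8 (17)] -/
theorem smul {x : ZMod d → PowerSeries 𝒪[F]} (h : IsAdmissibleLevel p d hd σ₀ hθm u x) (a : 𝒪[F]) :
    IsAdmissibleLevel p d hd σ₀ hθm u (fun j => PowerSeries.C a * x j) := by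
  obtain ⟨y, hy, hyR⟩ := h
  exact ⟨a • y, hy.smul a, Submodule.smul_mem _ a hyR⟩

/-- Admissibility only depends on `x mod ω_m`. [cite: deShalit1987, Ch. I §3.8 (17)] -/
theorem congr_of_dvd {x x' : ZMod d → PowerSeries 𝒪[F]} (h : IsAdmissibleLevel p d hd σ₀ hθm u x)
    (hxx' : ∀ j, ((1 + PowerSeries.X : PowerSeries 𝒪[F]) ^ p ^ m - 1) ∣ x j - x' j) : IsAdmissibleLevel p d hd σ₀ hθm u x' := by
  obtain ⟨y, hy, hyR⟩ := h
  exact ⟨y, hy.congr_of_dvd hxx', hyR⟩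

include hE hdeg hσ₀ in
/-- ★ **Admissibility is stable under multiplication by `(1+X)^i`** (the partner moves by `φ_m^{i t_m}`, which preserves the anomaly range).
[cite: deShalit1987, Ch. I §3.8 (17)] -/
theorem one_add_X_pow_mul [NeZero d] {x : ZMod d → PowerSeries 𝒪[F]} (h : IsAdmissibleLevel p d hd σ₀ hθm u x) (i : ℕ) :
    IsAdmissibleLevel p d hd σ₀ hθm u (fun j => (1 + PowerSeries.X) ^ i * x j) := by
  obtain ⟨y, hy, hyR⟩ := h
  exact ⟨_, hy.one_add_X_pow_mul hE hdeg hσ₀ i, unitBallEquiv_pow_mem_anomalyRange _ hyR⟩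

include hE hdeg hσ₀ in
/-- ★★ **Admissibility is stable under multiplication by ANY `s ∈ 𝒪_F⟦X⟧`**: `s ≡ Σ_{i ∈ ℤ/p^m} C(a_i)(1+X)^i (mod ω_m)`
(`existsUnique_omega_dvd_sub_amice`, Washington 7.1), and each `C(a_i)(1+X)^i·x` is admissible. [cite: deShalit1987, Ch. I §3.8 (17)] -/
theorem C_mul [NeZero d] [IsAdicComplete (Ideal.span {(p : 𝒪[F])}) 𝒪[F]] (hI : Ideal.span {(p : 𝒪[F])} ≠ ⊤) {x : ZMod d → PowerSeries 𝒪[F]}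
    (h : IsAdmissibleLevel p d hd σ₀ hθm u x) (s : PowerSeries 𝒪[F]) : IsAdmissibleLevel p d hd σ₀ hθm u (fun j => s * x j) := by
  obtain ⟨a, ha, -⟩ := existsUnique_omega_dvd_sub_amice p hI m s
  have hsum : IsAdmissibleLevel p d hd σ₀ hθm u (∑ i : ZMod (p ^ m), fun j => PowerSeries.C (a i) * ((1 + PowerSeries.X) ^ i.val * x j)) :=
    sum _ fun i _ => (h.one_add_X_pow_mul hE hdeg hσ₀ i.val).smul (a i)
  refine hsum.congr_of_dvd fun j => ?_
  rw [Finset.sum_apply]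
  have e : ∑ i : ZMod (p ^ m), PowerSeries.C (a i) * ((1 + PowerSeries.X) ^ i.val * x j) - s * x j =
      -((s - ∑ i : ZMod (p ^ m), PowerSeries.C (a i) * (1 + PowerSeries.X) ^ i.val) * x j) := by
    rw [sub_mul, sum_mul, neg_sub]
    refine congrArg (· - _) (sum_congr rfl fun i _ => ?_)
    rw [mul_assoc]
  rw [e]
  exact (dvd_mul_of_dvd_left ha _).neg_right

/-- ★ **Multiples of `π^N` are admissible** when `π^N 𝒪_{E_m} ⊆ (1 − uφ_m)𝒪_{E_m}` (the anomaly exponent of `exists_pow_smul_mem_anomalyRange`),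
provided the element has a partner at all. [cite: deShalit1987, Ch. I §3.7, §3.8 (17)] -/
theorem of_pow_mul {N : ℕ} (hN : ∀ c : unitBall (E m), π ^ N • c ∈ anomalyRange σ₀ (E m) u) {x' : ZMod d → PowerSeries 𝒪[F]}
    {y' : unitBall (E m)} (hy' : IsAmiceLevel p d hd σ₀ hθm x' y') :
    IsAdmissibleLevel p d hd σ₀ hθm u (fun j => PowerSeries.C (π ^ N) * x' j) :=
  ⟨π ^ N • y', hy'.smul (π ^ N), hN y'⟩

include hE hdeg hσ₀ in
/-- **Using admissibility**: any level-`m` partner of an admissible `x` lies in the anomaly range (partners are unique).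
[cite: deShalit1987, Ch. I §3.8 (17)] -/
theorem mem_of_isAmiceLevel [NeZero d] [IsAdicComplete (Ideal.span {(p : 𝒪[F])}) 𝒪[F]] (hI : Ideal.span {(p : 𝒪[F])} ≠ ⊤)
    {x : ZMod d → PowerSeries 𝒪[F]} (h : IsAdmissibleLevel p d hd σ₀ hθm u x) {y : unitBall (E m)} (hy : IsAmiceLevel p d hd σ₀ hθm x y) :
    y ∈ anomalyRange σ₀ (E m) u := by
  obtain ⟨y', hy', hy'R⟩ := h
  rwa [hy.unique hE hdeg hσ₀ hI hy']

end IsAdmissibleLevel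



end AmiceLevel

end Literature.NumberTheory.GaloisRepresentations
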